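import Literature.Computability.Complexity.PaulPippengerSzemerediTrotter1983Shapes
import HarnessLib

/-!
# Records as segments of the token stream: the decoders are segment-local (PPST 1983, §3 — the verifier, part 4)

Literature / complexity toolkit, twenty-sixth brick of the inline formalization of
Paul–Pippenger–Szemerédi–Trotter 1983 (`PaulPippengerSzemerediTrotter1983.lean`, fact
`PaulEtAl1983_NTIME_not_subset_DTIME`; roadmap Layer 4, machines, part 7). The verifier finds
the `m`-th record of `y₁` by counting end-of-record tokens in one pass (`…Locate.lean`). For this
to read the `m`-th DECODED record (`…Formats.lean`), the record parser must be segment-local: a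
record is exactly the segment up to its end-of-record token, fields contain no such token, and
parsing the segment alone gives the same record. This file proves that:

* `field_eq_some_iff` (a parsed field is `bits ++ [sep]` verbatim), `NoStop`, prefix replay
  `field_append`, `groups_append`, `numsP_append`, `hvP_append`;
* `splitAtStop`, `nthSeg` (the `m`-th segment), `splitAtStop_append`;
* **`recP_segment`**: `recP K ts = some (r, ts') → ∃ pre, NoStop pre ∧ ts = pre ++ .stop :: ts' ∧
  recP K (pre ++ [.stop]) = some (r, [])`;
* **`recsP_nthSeg`**: `recsP K f ts = some rs → m < rs.length → ∃ pre ts', nthSeg m ts = some (pre ++ [.stop], ts') ∧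
  recP K (pre ++ [.stop]) = some (rs[m], [])` (and the same for entries: `entryP_segment`,
  `entriesP_nthSeg`).

No named fact is introduced (definitions with bodies and theorems only).

## References

* W. J. Paul, N. Pippenger, E. Szemerédi, W. T. Trotter, *On determinism versus non-determinism
  and related problems*, FOCS 1983, 429–438, §3 [PaulEtAl1983].
-/

namespace Literature.Computability.Complexity

open Function

namespace PPSTSpec

/-! ### Fields are verbatim prefixes -/

/-- A parsed field is its bits then the end-of-field token, verbatim. [folklore] -/
theorem field_eq_some_iff : ∀ (ts : List Tok) (w : List Bool) (ts' : List Tok),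
    field ts = some (w, ts') ↔ ts = w.map Tok.bit ++ .sep :: ts'
  | [], w, ts' => by simp [field]
  | .bit d :: ts, w, ts' => by
    simp only [field, Option.map_eq_some_iff, Prod.exists, Prod.mk.injEq]
    constructor
    · rintro ⟨w', ts'', h, rfl, rfl⟩
      rw [(field_eq_some_iff ts w' ts'').1 h]; simp
    · intro h
      cases w with
      | nil => simp at h
      | cons b w =>
        simp only [List.map_cons, List.cons_append, List.cons.injEq, Tok.bit.injEq] at h
        obtain ⟨rfl, rfl⟩ := h
        exact ⟨w, ts', (field_eq_some_iff _ w ts').2 rfl, rfl, rfl⟩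
  | .sep :: ts, w, ts' => by
    simp only [field, Option.some.injEq, Prod.mk.injEq]
    constructor
    · rintro ⟨rfl, rfl⟩; simp
    · intro h
      cases w with
      | nil => simpa using h
      | cons b w => simp at h
  | .stop :: ts, w, ts' => by
    simp only [field, reduceCtorEq, false_iff]
    intro h; cases w <;> simp at h

/-- No end-of-record token. [folklore] -/
def NoStop (ts : List Tok) : Prop := Tok.stop ∉ ts

/-- Mapped bits have no end of record. [folklore] -/
theorem noStop_map_bit (w : List Bool) : NoStop (w.map Tok.bit) := by simp [NoStop]

/-- **Prefix replay for fields**: a field parses the same in front of anything. [folklore] -/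
theorem field_append {ts : List Tok} {w : List Bool} {ts' tail : List Tok} (h : field ts = some (w, ts')) :
    field (ts ++ tail) = some (w, ts' ++ tail) := by
  rw [field_eq_some_iff] at h ⊢
  rw [h]; simp

/-- The prefix consumed by a field. [folklore] -/
theorem field_prefix {ts : List Tok} {w : List Bool} {ts' : List Tok} (h : field ts = some (w, ts')) :
    ∃ pre, NoStop pre ∧ ts = pre ++ ts' ∧ ∀ tail, field (pre ++ tail) = some (w, tail) := by
  rw [field_eq_some_iff] at h
  refine ⟨w.map Tok.bit ++ [.sep], by simp [NoStop], by rw [h]; simp, fun tail => ?_⟩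
  rw [field_eq_some_iff]; simp

/-- **Prefix replay for groups.** [folklore] -/
theorem groups_prefix {α : Type} {p : List Tok → Option (α × List Tok)}
    (hp : ∀ {ts a ts'}, p ts = some (a, ts') → ∃ pre, NoStop pre ∧ ts = pre ++ ts' ∧ ∀ tail, p (pre ++ tail) = some (a, tail)) :
    ∀ (n : ℕ) {ts : List Tok} {as : List α} {ts' : List Tok}, groups p n ts = some (as, ts') →
      ∃ pre, NoStop pre ∧ ts = pre ++ ts' ∧ ∀ tail, groups p n (pre ++ tail) = some (as, tail)
  | 0, ts, as, ts', h => by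
    simp only [groups, Option.some.injEq, Prod.mk.injEq] at h
    obtain ⟨rfl, rfl⟩ := h
    exact ⟨[], by simp [NoStop], rfl, fun tail => rfl⟩
  | n + 1, ts, as, ts', h => by
    simp only [groups, Option.bind_eq_bind, Option.bind_eq_some_iff, Prod.exists] at h
    obtain ⟨a, ts₁, h1, as', ts₂, h2, h3⟩ := h
    simp only [Option.some.injEq, Prod.mk.injEq] at h3
    obtain ⟨rfl, rfl⟩ := h3
    obtain ⟨pre₁, hn₁, rfl, hr₁⟩ := hp h1
    obtain ⟨pre₂, hn₂, rfl, hr₂⟩ := groups_prefix hp n h2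
    refine ⟨pre₁ ++ pre₂, by simp [NoStop] at hn₁ hn₂ ⊢; exact ⟨hn₁, hn₂⟩, by simp, fun tail => ?_⟩
    simp only [groups, List.append_assoc, hr₁ (pre₂ ++ tail), Option.bind_eq_bind, Option.bind_some, hr₂ tail]

/-- Prefix replay for number groups. [folklore] -/
theorem numsP_prefix {ts : List Tok} {g : Nums} {ts' : List Tok} (h : numsP ts = some (g, ts')) :
    ∃ pre, NoStop pre ∧ ts = pre ++ ts' ∧ ∀ tail, numsP (pre ++ tail) = some (g, tail) := by
  simp only [numsP, Option.bind_eq_bind, Option.bind_eq_some_iff, Prod.exists, Option.some.injEq, Prod.mk.injEq] at h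
  obtain ⟨w₁, t₁, h₁, w₂, t₂, h₂, w₃, t₃, h₃, w₄, t₄, h₄, w₅, t₅, h₅, w₆, t₆, h₆, w₇, t₇, h₇, rfl, rfl⟩ := h
  obtain ⟨p₁, n₁, rfl, r₁⟩ := field_prefix h₁
  obtain ⟨p₂, n₂, rfl, r₂⟩ := field_prefix h₂
  obtain ⟨p₃, n₃, rfl, r₃⟩ := field_prefix h₃
  obtain ⟨p₄, n₄, rfl, r₄⟩ := field_prefix h₄
  obtain ⟨p₅, n₅, rfl, r₅⟩ := field_prefix h₅
  obtain ⟨p₆, n₆, rfl, r₆⟩ := field_prefix h₆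
  obtain ⟨p₇, n₇, rfl, r₇⟩ := field_prefix h₇
  refine ⟨p₁ ++ p₂ ++ p₃ ++ p₄ ++ p₅ ++ p₆ ++ p₇, ?_, by simp, fun tail => ?_⟩
  · simp only [NoStop, List.mem_append, not_or] at n₁ n₂ n₃ n₄ n₅ n₆ n₇ ⊢
    exact ⟨⟨⟨⟨⟨⟨n₁, n₂⟩, n₃⟩, n₄⟩, n₅⟩, n₆⟩, n₇⟩
  · simp only [numsP, List.append_assoc, Option.bind_eq_bind, r₁, Option.bind_some, r₂, r₃, r₄, r₅, r₆, r₇]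

/-- Prefix replay for heavy groups. [folklore] -/
theorem hvP_prefix {ts : List Tok} {g : Hv} {ts' : List Tok} (h : hvP ts = some (g, ts')) :
    ∃ pre, NoStop pre ∧ ts = pre ++ ts' ∧ ∀ tail, hvP (pre ++ tail) = some (g, tail) := by
  simp only [hvP, Option.bind_eq_bind, Option.bind_eq_some_iff, Prod.exists, Option.some.injEq, Prod.mk.injEq] at h
  obtain ⟨w₁, t₁, h₁, w₂, t₂, h₂, rfl, rfl⟩ := h
  obtain ⟨p₁, n₁, rfl, r₁⟩ := field_prefix h₁
  obtain ⟨p₂, n₂, rfl, r₂⟩ := field_prefix h₂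
  refine ⟨p₁ ++ p₂, ?_, by simp, fun tail => ?_⟩
  · simp only [NoStop, List.mem_append, not_or] at n₁ n₂ ⊢; exact ⟨n₁, n₂⟩
  · simp only [hvP, List.append_assoc, Option.bind_eq_bind, r₁, Option.bind_some, r₂]

/-- Prefix replay for entry groups. [folklore] -/
theorem egP_prefix {ts : List Tok} {g : Eg} {ts' : List Tok} (h : egP ts = some (g, ts')) :
    ∃ pre, NoStop pre ∧ ts = pre ++ ts' ∧ ∀ tail, egP (pre ++ tail) = some (g, tail) := by
  simp only [egP, Option.bind_eq_bind, Option.bind_eq_some_iff, Prod.exists, Option.some.injEq,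
    Prod.mk.injEq] at h
  obtain ⟨w₁, t₁, h₁, w₂, t₂, h₂, w₃, t₃, h₃, w₄, t₄, h₄, w₅, t₅, h₅, w₆, t₆, h₆, rfl, rfl⟩ := h
  obtain ⟨p₁, n₁, rfl, r₁⟩ := field_prefix h₁
  obtain ⟨p₂, n₂, rfl, r₂⟩ := field_prefix h₂
  obtain ⟨p₃, n₃, rfl, r₃⟩ := field_prefix h₃
  obtain ⟨p₄, n₄, rfl, r₄⟩ := field_prefix h₄
  obtain ⟨p₅, n₅, rfl, r₅⟩ := field_prefix h₅
  obtain ⟨p₆, n₆, rfl, r₆⟩ := field_prefix h₆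
  refine ⟨p₁ ++ p₂ ++ p₃ ++ p₄ ++ p₅ ++ p₆, ?_, by simp, fun tail => ?_⟩
  · simp only [NoStop, List.mem_append, not_or] at n₁ n₂ n₃ n₄ n₅ n₆ ⊢
    exact ⟨⟨⟨⟨⟨n₁, n₂⟩, n₃⟩, n₄⟩, n₅⟩, n₆⟩
  · simp only [egP, List.append_assoc, Option.bind_eq_bind, r₁, Option.bind_some, r₂, r₃, r₄, r₅, r₆]

/-! ### Segments -/

/-- Split off the segment up to and including the first end-of-record token. [folklore] -/
def splitAtStop : List Tok → Option (List Tok × List Tok)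
  | [] => none
  | .stop :: ts => some ([.stop], ts)
  | t :: ts => (splitAtStop ts).map fun p => (t :: p.1, p.2)

/-- The `m`-th segment and what follows it. [folklore] -/
def nthSeg : ℕ → List Tok → Option (List Tok × List Tok)
  | 0, ts => splitAtStop ts
  | m + 1, ts => (splitAtStop ts).bind fun p => nthSeg m p.2

/-- Splitting in front of a stop-free prefix. [folklore] -/
theorem splitAtStop_append {pre : List Tok} (hpre : NoStop pre) (ts' : List Tok) :
    splitAtStop (pre ++ .stop :: ts') = some (pre ++ [.stop], ts') := by
  induction pre with
  | nil => rfl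
  | cons t pre ih =>
    have ht : t ≠ .stop := by rintro rfl; simp [NoStop] at hpre
    have hpre' : NoStop pre := by simp [NoStop] at hpre ⊢; exact hpre.2
    cases t with
    | bit d => simp only [List.cons_append, splitAtStop, ih hpre']; rfl
    | sep => simp only [List.cons_append, splitAtStop, ih hpre']; rfl
    | stop => exact absurd rfl ht

/-! ### Records and entries are segments -/

/-- **A record is a segment**, parsed the same on its own. [folklore] -/
theorem recP_segment (K : ℕ) {ts : List Tok} {r : Rec K} {ts' : List Tok} (h : recP K ts = some (r, ts')) :
    ∃ pre, NoStop pre ∧ ts = pre ++ .stop :: ts' ∧ recP K (pre ++ [.stop]) = some (r, []) := by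
  simp only [recP, Option.bind_eq_bind, Option.bind_eq_some_iff, Prod.exists] at h
  obtain ⟨pcw, t₁, h₁, ns, t₂, h₂, jb, t₃, h₃, hs, t₄, h₄, h₅⟩ := h
  obtain ⟨p₁, n₁, rfl, r₁⟩ := field_prefix h₁
  obtain ⟨p₂, n₂, rfl, r₂⟩ := groups_prefix numsP_prefix K h₂
  obtain ⟨p₃, n₃, rfl, r₃⟩ := field_prefix h₃
  obtain ⟨p₄, n₄, rfl, r₄⟩ := groups_prefix hvP_prefix K h₄
  split at h₅
  · rename_i ts''
    simp only [Option.some.injEq, Prod.mk.injEq] at h₅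
    obtain ⟨rfl, rfl⟩ := h₅
    refine ⟨p₁ ++ p₂ ++ p₃ ++ p₄, ?_, by simp, ?_⟩
    · simp only [NoStop, List.mem_append, not_or] at n₁ n₂ n₃ n₄ ⊢; exact ⟨⟨⟨n₁, n₂⟩, n₃⟩, n₄⟩
    · simp only [recP, List.append_assoc, Option.bind_eq_bind, r₁, Option.bind_some, r₂, r₃, r₄]
  · simp at h₅

/-- **The `m`-th record is the `m`-th segment.** [folklore] -/
theorem recsP_nthSeg (K : ℕ) : ∀ (f : ℕ) (ts : List Tok) (rs : List (Rec K)), recsP K f ts = some rs →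
    ∀ m (hm : m < rs.length), ∃ pre ts', NoStop pre ∧ nthSeg m ts = some (pre ++ [.stop], ts') ∧
      recP K (pre ++ [.stop]) = some (rs[m], [])
  | f, [], rs, h, m, hm => by
    have : rs = [] := by cases f <;> simp [recsP] at h <;> exact h
    subst this; simp at hm
  | 0, _ :: _, rs, h, m, hm => by simp [recsP] at h
  | f + 1, t :: ts, rs, h, m, hm => by
    simp only [recsP, Option.bind_eq_bind, Option.bind_eq_some_iff, Prod.exists] at h
    obtain ⟨r, ts₁, h1, rs', h2, h3⟩ := h
    simp only [Option.some.injEq] at h3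
    subst h3
    obtain ⟨pre, hpre, hts, hrec⟩ := recP_segment K h1
    cases m with
    | zero =>
      refine ⟨pre, ts₁, hpre, ?_, by simpa using hrec⟩
      show splitAtStop (t :: ts) = _
      rw [hts, splitAtStop_append hpre]
    | succ m =>
      simp only [List.length_cons] at hm
      obtain ⟨pre', ts', hpre', hseg, hrec'⟩ := recsP_nthSeg K f ts₁ rs' h2 m (by omega)
      refine ⟨pre', ts', hpre', ?_, by simpa using hrec'⟩
      show (splitAtStop (t :: ts)).bind (fun p => nthSeg m p.2) = _
      rw [hts, splitAtStop_append hpre, Option.bind_some]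
      exact hseg

/-- **An entry is a segment**, parsed the same on its own. [folklore] -/
theorem entryP_segment (K : ℕ) {ts : List Tok} {e : Entry K} {ts' : List Tok} (h : entryP K ts = some (e, ts')) :
    ∃ pre, NoStop pre ∧ ts = pre ++ .stop :: ts' ∧ entryP K (pre ++ [.stop]) = some (e, []) := by
  simp only [entryP, Option.bind_eq_bind, Option.bind_eq_some_iff, Prod.exists] at h
  obtain ⟨uw, t₁, h₁, hs, t₂, h₂, h₃⟩ := h
  obtain ⟨p₁, n₁, rfl, r₁⟩ := field_prefix h₁
  obtain ⟨p₂, n₂, rfl, r₂⟩ := groups_prefix egP_prefix K h₂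
  split at h₃
  · rename_i ts''
    simp only [Option.some.injEq, Prod.mk.injEq] at h₃
    obtain ⟨rfl, rfl⟩ := h₃
    refine ⟨p₁ ++ p₂, ?_, by simp, ?_⟩
    · simp only [NoStop, List.mem_append, not_or] at n₁ n₂ ⊢; exact ⟨n₁, n₂⟩
    · simp only [entryP, List.append_assoc, Option.bind_eq_bind, r₁, Option.bind_some, r₂]
  · simp at h₃

/-- **The `m`-th entry is the `m`-th segment.** [folklore] -/
theorem entriesP_nthSeg (K : ℕ) : ∀ (f : ℕ) (ts : List Tok) (es : List (Entry K)), entriesP K f ts = some es →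
    ∀ m (hm : m < es.length), ∃ pre ts', NoStop pre ∧ nthSeg m ts = some (pre ++ [.stop], ts') ∧
      entryP K (pre ++ [.stop]) = some (es[m], [])
  | f, [], es, h, m, hm => by
    have : es = [] := by cases f <;> simp [entriesP] at h <;> exact h
    subst this; simp at hm
  | 0, _ :: _, es, h, m, hm => by simp [entriesP] at h
  | f + 1, t :: ts, es, h, m, hm => by
    simp only [entriesP, Option.bind_eq_bind, Option.bind_eq_some_iff, Prod.exists] at h
    obtain ⟨e, ts₁, h1, es', h2, h3⟩ := h
    simp only [Option.some.injEq] at h3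
    subst h3
    obtain ⟨pre, hpre, hts, hrec⟩ := entryP_segment K h1
    cases m with
    | zero =>
      refine ⟨pre, ts₁, hpre, ?_, by simpa using hrec⟩
      show splitAtStop (t :: ts) = _
      rw [hts, splitAtStop_append hpre]
    | succ m =>
      simp only [List.length_cons] at hm
      obtain ⟨pre', ts', hpre', hseg, hrec'⟩ := entriesP_nthSeg K f ts₁ es' h2 m (by omega)
      refine ⟨pre', ts', hpre', ?_, by simpa using hrec'⟩
      show (splitAtStop (t :: ts)).bind (fun p => nthSeg m p.2) = _
      rw [hts, splitAtStop_append hpre, Option.bind_some]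
      exact hseg

end PPSTSpec

end Literature.Computability.Complexity
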